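import Summits.BirchSwinnertonDyer.BirchSwinnertonDyer.Theses.TeichmullerTwistDescent

/-!
# Route TeichmullerTwistDescent — the assembly item (stmt-BirchSwinnertonDyer-22641)

`Assembly` is the route's deciding theorem `closes` curried: the eight route items imply the
registered leaf `Summit.BirchSwinnertonDyer.WAllExclAdditiveFiveLeRankOne` (rung W-ALL/2.p>=5.r1).
No summit statement and no leaf is proved unconditionally here; BSD is not proved by this.
-/

-- single-conjunct summit: `Summit.BirchSwinnertonDyer.BirchSwinnertonDyer.…` repeats the name by design
set_option linter.dupNamespace false

namespace Summit.BirchSwinnertonDyer.BirchSwinnertonDyer.Theorems.TeichmullerTwistDescentAssembly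

/-- The assembly item of route TeichmullerTwistDescent (stmt-BirchSwinnertonDyer-22641): the route's
items PSMU, SCMU57, G-WT, KolyvaginPrimitiveAdditive, RankZeroAdditive, OffSharpRankOneAdditive,
PublishedInputsAdditiveKoly and PublishedManinFacts together give the leaf
`Summit.BirchSwinnertonDyer.WAllExclAdditiveFiveLeRankOne`; this is the planner's deciding theorem
`Theses.TeichmullerTwistDescent.closes`, curried. -/
theorem assembly_proof :
    Summit.BirchSwinnertonDyer.BirchSwinnertonDyer.Theses.TeichmullerTwistDescent.Assembly := by
  unfold Summit.BirchSwinnertonDyer.BirchSwinnertonDyer.Theses.TeichmullerTwistDescent.Assembly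
  intro hPS hSC hG h₁ h₀ hoff hP hF
  -- The route's `closes` was re-keyed (rev 2026-08-27T23:54Z) to the cell items (Corner / LOW / ≥ 11 /
  -- OfCells / OfCell / KatoNeronAndCremonaFacts), from which it first DERIVES `hPS` and `hSC`; the accepted
  -- `Assembly` statement takes PSMU and SCMU57 directly, so the remainder of the chain of `closes` is
  -- inlined here verbatim (proper Manin residue R → residue class → Manin-good odd frame → ♯ / off-♯ glue).
  classical
  obtain ⟨e1, e2, dd, mz, au, c2, hC⟩ := hF
  -- (1) the proper Manin residue `R` of route AdditiveKolyvaginRoad from PSMU, SCMU57 and the Weil-type glue G-WT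
  have hR : Summit.BirchSwinnertonDyer.BirchSwinnertonDyer.Theses.AdditiveKolyvaginRoad.ManinFrameResidueProperR := by
    intro e1' e2' dd' hPub W _ _ p hp _ hp5 hadd hirr hres hall hr
    have hnf' : Literature.NumberTheory.EllipticCurves.ModularForms.exists_isNewformOf := hPub.2.2.2.2.2.1
    have hmem : ∃ (W₀ : WeierstrassCurve ℚ) (_ : W₀.IsElliptic) (_ : W₀.IsGloballyMinimal)
        (D₀ : Literature.NumberTheory.EllipticCurves.ModularForms.ModularParametrizationData W₀
          (W.conductorNorm ℤ)), WeierstrassCurve.IsIsogenous W W₀ ∧ ¬ (p : ℤ) ∣ D₀.c :=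
      hG hnf' hPS hSC W p hp5 hadd hirr hres
    obtain ⟨W₀, hE₀, hM₀, D₀, hiso, hc₀⟩ := hmem
    haveI := hE₀
    haveI := hM₀
    obtain ⟨Dt, hc⟩ :=
      Summit.BirchSwinnertonDyer.BirchSwinnertonDyer.Theorems.ManinFrameTransport.exists_modularParametrizationData_not_dvd_of_partner
        W hp.out hirr hiso D₀ hc₀
    have hp2 : p ≠ 2 := by omega
    exact Summit.BirchSwinnertonDyer.BirchSwinnertonDyer.Theorems.ManinFrameFromDatum.exists_oddHeegnerFrame_of_exists_not_dvd
      hnf' hPub.2.2.2.2.2.2.1 W p hr hp2 ⟨Dt, hc⟩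
  -- (2) the Manin residue class from ČNS + the proved degree class + R
  have hD : Summit.BirchSwinnertonDyer.BirchSwinnertonDyer.Theses.AdditiveKolyvaginRoad.ManinFrameResidueDegreeClass :=
    Summit.BirchSwinnertonDyer.BirchSwinnertonDyer.Theorems.ManinFrameResidueDegreeClass.maninFrameResidueDegreeClass_proof
  have hRes : Summit.BirchSwinnertonDyer.BirchSwinnertonDyer.Theses.AdditiveKolyvaginRoad.ManinFrameResidueClass := by
    intro hP' W _ _ p _ _ h5 hadd hirr hcl hr1
    by_cases hex : ∃ (W' : WeierstrassCurve ℚ) (_ : W'.IsElliptic) (_ : W'.IsGloballyMinimal)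
        (D' : Literature.NumberTheory.EllipticCurves.ModularForms.ModularParametrizationData W' (W.conductorNorm ℤ)),
        WeierstrassCurve.IsIsogenous W W' ∧ ¬ p ∣ D'.modularDegree
    · exact hD hC hP' W p h5 hadd hirr hcl hex hr1
    · refine hR e1 e2 dd hP' W p h5 hadd hirr hcl ?_ hr1
      intro W' _ _ D' hiso
      by_contra hnd
      exact hex ⟨W', ‹_›, ‹_›, D', hiso, hnd⟩
  -- (3) the Manin-good odd frame by the proved gen-2 glue over the proved class loci
  have hM : Summit.BirchSwinnertonDyer.BirchSwinnertonDyer.Theses.AdditiveKolyvaginRoad.ManinGoodOddFrameAdditive :=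
    Summit.BirchSwinnertonDyer.BirchSwinnertonDyer.Theorems.ManinGoodOddFrameAdditiveResplitGlue.maninGoodOddFrameAdditiveResplitGlue_proof
      e1 e2 mz au c2
      Summit.BirchSwinnertonDyer.BirchSwinnertonDyer.Theorems.ManinFrameOffExceptionClass.maninFrameOffExceptionClass_proof
      Summit.BirchSwinnertonDyer.BirchSwinnertonDyer.Theorems.ManinFrameIstarClass.maninFrameIstarClass_proof hRes
  -- (4) the proved additive Kolyvagin kernel gives the ♯ slice; the off-♯ slice is the item; glue of the W-ALL leaf
  have hSharp : Summit.BirchSwinnertonDyer.WAllExclAdditiveFiveLeRankOneSharp :=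
    fun W _ _ p _ hCM hp5 hadd hr1 hs hsp htwo htam =>
      Summit.BirchSwinnertonDyer.BirchSwinnertonDyer.Theorems.AdditiveKolyvaginKernel.additiveKolyvaginKernel_proof
        hP hM h₁ h₀ W p hCM hp5 hadd hr1 hs hsp htwo htam
  exact Summit.BirchSwinnertonDyer.wAllExclAdditiveFiveLeRankOne_of_sharp_of_offSharp hSharp hoff

end Summit.BirchSwinnertonDyer.BirchSwinnertonDyer.Theorems.TeichmullerTwistDescentAssembly
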